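import Literature.Claims.NS.Solanki2026
import Literature.Analysis.FunctionSpaces.LatticeWeightedYoung
import Literature.Analysis.FunctionSpaces.TorusGevreySobolevBounds
import HarnessLib

/-!
# C176 `Solanki2026` — SALVAGE (TRUE column): Lemma 1's first sentence and the «Gevrey Banach algebra»
# property, in the skeleton's vocabulary

Cell `ns-claims` (D-0090), salvage seat ns-claims-salvage-p2 g6; claim skeleton
`Literature/Claims/NS/Solanki2026.lean` (typist-5 g7, rev 1 p552494). RECORDS-GRADE, TRUE column only: this
file keys nothing (no locator, no verdict) and touches no consumed binder.

WHAT IS TRUE IN LEMMA 1 (p.2 l.4–13): «For interacting modes k = p + q, the exponential weight satisfies the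
sub-additive property e^{√t|k|} ≤ e^{√t|p|} e^{√t|q|}. In the Gevrey Banach algebra, …». With the skeleton's
weight `gevreyWeight ν t k = exp (√(νt) · |k|)` (l.70; `√(νt) ≥ 0` for ALL real `ν, t` since `Real.sqrt ≥ 0`):

* `gevreyWeight_submul` / `gevreyWeight_add_le` — the weight is submultiplicative under `k = (k − l) + l`,
  resp. `k = p + q` (triangle inequality for `|k| = √(freqNormSq k)`);
* `tsum_gevreyWeight_conv_le` — hence the weighted `ℓ¹` class of Definition 1 is an ALGEBRA under lattice
  convolution (= Fourier side of pointwise products): for nonnegative `[0,∞]`-valued coefficient families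
  `α, β` on `ℤ³`, `∑_k w(k) (α ⋆ β)(k) ≤ (∑_k w(k) α(k)) (∑_l w(l) β(l))`, `w = gevreyWeight ν t` — constant `1`,
  no factor `√t`, and NO derivative absorbed (the typed Step `Step_L1`, display (2), concerns `B v = (v·∇)v`,
  which carries one derivative; that display is the refuter's object and is not touched here).

Kernel: the generic lattice tool `Literature/Analysis/FunctionSpaces/LatticeWeightedYoung.lean` (p552714):
`NSGevrey.exp_mul_sqrt_freqNormSq_le_mul`, `NSGevrey.tsum_exp_mul_conv_le` (weighted Young `ℓ¹ ⋆ ℓ¹ ⊂ ℓ¹`).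

[cite: Solanki2026, Lemma 1 p.2 l.4–13; Def 1 (1) p.1 l.23–31]
[cite: FoiasTemam1989, Lemma 2.1] [cite: Katznelson2004, Ch. I §6]

WHAT THIS IS NOT: not a claim about NS regularity or blow-up; not a claim about any author beyond the typed
locator.
-/

set_option linter.dupNamespace false

noncomputable section

open scoped ENNReal

namespace Summit.NavierStokesRegularity.NavierStokesRegularity.Theorems.Solanki2026Salvage

open Literature.Claims.NS.Solanki2026 Literature.Analysis.FluidPDE
open Literature.Claims.NS.Faliush2026 (Z3)

/-- **Lemma 1, first sentence (submultiplicativity of Definition 1's weight)**: for all real `ν, t` and all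
frequencies `k, l ∈ ℤ³`, `e^{√(νt)|k|} ≤ e^{√(νt)|k−l|} · e^{√(νt)|l|}`.
[cite: Solanki2026, Lemma 1 p.2 l.4–13] [cite: FoiasTemam1989, Lemma 2.1] -/
theorem gevreyWeight_submul (ν t : ℝ) (k l : Z3) :
    gevreyWeight ν t k ≤ gevreyWeight ν t (k - l) * gevreyWeight ν t l := by
  unfold gevreyWeight freqNorm
  exact NSGevrey.exp_mul_sqrt_freqNormSq_le_mul (Real.sqrt_nonneg _) k l

/-- **Lemma 1, first sentence, as printed** («for interacting modes k = p + q …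
e^{√t|k|} ≤ e^{√t|p|} e^{√t|q|}»): `e^{√(νt)|p+q|} ≤ e^{√(νt)|p|} · e^{√(νt)|q|}`.
[cite: Solanki2026, Lemma 1 p.2 l.4–13] -/
theorem gevreyWeight_add_le (ν t : ℝ) (p q : Z3) :
    gevreyWeight ν t (p + q) ≤ gevreyWeight ν t p * gevreyWeight ν t q := by
  have h := gevreyWeight_submul ν t (p + q) q
  rwa [add_sub_cancel_right] at h

/-- **«In the Gevrey Banach algebra»** (p.2 l.13): Definition 1's weighted `ℓ¹` class is an algebra under
lattice convolution — for nonnegative `[0,∞]`-valued coefficient families `α, β` on `ℤ³` and all real `ν, t`,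
`∑_k w(k) ∑_l α(k−l) β(l) ≤ (∑_k w(k) α(k)) · (∑_l w(l) β(l))` with `w = gevreyWeight ν t` (weighted Young
`ℓ¹ ⋆ ℓ¹ ⊂ ℓ¹`; constant `1`, no `√t`, no derivative). [cite: Solanki2026, Lemma 1 p.2 l.4–13; App. A (4)–(5) p.3 l.7–34]
[cite: Katznelson2004, Ch. I §6] -/
theorem tsum_gevreyWeight_conv_le (ν t : ℝ) (α β : Z3 → ℝ≥0∞) :
    ∑' k, ENNReal.ofReal (gevreyWeight ν t k) * ∑' l, α (k - l) * β l ≤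
      (∑' k, ENNReal.ofReal (gevreyWeight ν t k) * α k) *
        ∑' l, ENNReal.ofReal (gevreyWeight ν t l) * β l := by
  unfold gevreyWeight freqNorm
  exact NSGevrey.tsum_exp_mul_conv_le (Real.sqrt_nonneg _) α β

/-! ### Addendum (after ADJUDICATED #161): Definition 1 ⇒ the tree's Gevrey-ball hypothesis (`ℓ¹ ⊂ ℓ²`) -/

/-- The summands of Definition 1 are nonnegative. [cite: Solanki2026, Def 1 (1) p.1 l.23–31] -/
theorem gevreyTerm_nonneg (ν t : ℝ) (v : Literature.Claims.NS.Faliush2026.T3 → Literature.Claims.NS.Faliush2026.E3)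
    (k : Z3) : 0 ≤ gevreyTerm ν t v k := by
  unfold gevreyTerm
  exact mul_nonneg (norm_nonneg _) (Real.exp_nonneg _)

/-- **Definition 1 ⇒ Foias–Temam Gevrey ball** (`ℓ¹ ⊂ ℓ²`): a field with finite `G_R`-norm at `(ν, t)`
satisfies the tree's Gevrey bound of radius `σ = √(νt)` and level `‖u‖²_{G_R}`:
`∑_{k∈S} e^{2σ|k|} ‖û(k)‖² ≤ (∑_k e^{σ|k|} ‖û(k)‖)²` for every finite `S ⊆ ℤ³` — the hypothesis shape of
`Literature.Analysis.FunctionSpaces.Torus.norm_le_sqrt_mul_exp_neg_of_gevreyBound`,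
`summable_one_add_freqNormSq_pow_mul_norm_of_gevreyBound`, `TorusGevreyInterpolation`, `TorusNSGevreyAlgebra`, so
everything the tree proves for Foias–Temam's classes applies to the members of Definition 1's algebra. (What the
sentence «if ‖u(t)‖_{G_R} < ∞, the solution is analytic» p.1 l.32–35 gives: ONE slice in a Gevrey class; nothing
at other times.) [cite: Solanki2026, Def 1 p.1 l.23–35] [cite: FoiasTemam1989, Thm 1.1 (the classes `D(e^{σA^{1/2}})`)] -/
theorem gevreyBound_of_finiteGR {ν t : ℝ}
    {v : Literature.Claims.NS.Faliush2026.T3 → Literature.Claims.NS.Faliush2026.E3} (h : FiniteGR ν t v)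
    (S : Finset Z3) :
    ∑ k ∈ S, Real.exp (2 * Real.sqrt (ν * t) * Real.sqrt (Literature.Analysis.FunctionSpaces.Torus.freqNormSq k)) *
        ‖Literature.Claims.NS.Faliush2026.coeff v k‖ ^ 2 ≤ GR ν t v ^ 2 := by
  have hx0 : ∀ k, 0 ≤ gevreyTerm ν t v k := gevreyTerm_nonneg ν t v
  -- each summand is the square of Definition 1's summand
  have hsq : ∀ k, Real.exp (2 * Real.sqrt (ν * t) *
      Real.sqrt (Literature.Analysis.FunctionSpaces.Torus.freqNormSq k)) *
        ‖Literature.Claims.NS.Faliush2026.coeff v k‖ ^ 2 = gevreyTerm ν t v k ^ 2 := by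
    intro k
    unfold gevreyTerm gevreyWeight freqNorm
    rw [mul_pow, ← Real.exp_nat_mul]
    push_cast
    ring_nf
  simp_rw [hsq]
  -- `∑_S x² ≤ (∑_S x)²  ≤ (∑' x)² = GR²`
  have hS : ∑ k ∈ S, gevreyTerm ν t v k ≤ GR ν t v := by
    unfold GR
    exact h.sum_le_tsum S fun k _ => hx0 k
  have hS0 : 0 ≤ ∑ k ∈ S, gevreyTerm ν t v k := Finset.sum_nonneg fun k _ => hx0 k
  calc ∑ k ∈ S, gevreyTerm ν t v k ^ 2
      ≤ ∑ k ∈ S, gevreyTerm ν t v k * ∑ j ∈ S, gevreyTerm ν t v j := by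
        refine Finset.sum_le_sum fun k hk => ?_
        rw [sq]
        exact mul_le_mul_of_nonneg_left (Finset.single_le_sum (fun j _ => hx0 j) hk) (hx0 k)
    _ = (∑ k ∈ S, gevreyTerm ν t v k) ^ 2 := by rw [← Finset.sum_mul, sq]
    _ ≤ GR ν t v ^ 2 := pow_le_pow_left₀ hS0 hS 2

/-- **Modewise analytic decay from Definition 1**: `‖û(k)‖ ≤ ‖u‖_{G_R} · e^{−√(νt)|k|}` for every mode —
the one-slice content of «if ‖u(t)‖_{G_R} < ∞, the solution is analytic» (p.1 l.32–35), via the tree's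
`Torus.norm_le_sqrt_mul_exp_neg_of_gevreyBound`. [cite: Solanki2026, Def 1 p.1 l.32–35] -/
theorem norm_coeff_le_of_finiteGR {ν t : ℝ}
    {v : Literature.Claims.NS.Faliush2026.T3 → Literature.Claims.NS.Faliush2026.E3} (h : FiniteGR ν t v)
    (k : Z3) :
    ‖Literature.Claims.NS.Faliush2026.coeff v k‖ ≤
      GR ν t v * Real.exp (-(Real.sqrt (ν * t) *
        Real.sqrt (Literature.Analysis.FunctionSpaces.Torus.freqNormSq k))) := by
  have hGR : 0 ≤ GR ν t v := by
    unfold GR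
    exact tsum_nonneg (gevreyTerm_nonneg ν t v)
  have h' := Literature.Analysis.FunctionSpaces.Torus.norm_le_sqrt_mul_exp_neg_of_gevreyBound
    (gevreyBound_of_finiteGR h) k
  rwa [Real.sqrt_sq hGR] at h'

end Summit.NavierStokesRegularity.NavierStokesRegularity.Theorems.Solanki2026Salvage

end
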